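import Summits.ResolutionOfSingularities.ResolutionOfSingularities.Theorems.WeightedInvariantRegularSubschemeCentre
import Literature.AlgebraicGeometry.Resolution.PointCentrePermissible
import Literature.AlgebraicGeometry.Resolution.AlterationsSingularComponents
import Literature.AlgebraicGeometry.Resolution.SubschemeRegularStalks
import Literature.AlgebraicGeometry.Resolution.PointBlowupHsFunMono
import Mathlib.AlgebraicGeometry.Morphisms.FiniteType
import HarnessLib

/-!
# A singular closed subscheme of a smooth `k`-scheme admits a regular weighted centre inside its singular locus

Route `ResolutionOfSingularities/WeightedInvariant`, door crux `HypersurfaceCentreConstruction`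
(stmt-ResolutionOfSingularities-19897), helper #2 (summit-side, OURS). The door's datum
`HypersurfaceTerminatingCentreDatum p` asks, at every singular hypersurface pair `(Y, X)`, for a centre with
`(iii-a)` `IsRegularWeightedCentre` and `(iii-b′)` support inside the image of the non-regular locus of `V(X)`.
This file certifies in the kernel that these two clauses TOGETHER are always satisfiable (the designer memo's
§3 «not cheaply false: the admissible-centre set is non-empty at every guarded pair», in its cheapest instance):

* `exists_isClosed_not_isRegularLocalRing_quotient` — on a Jacobson scheme a non-regular `V(X)` has a CLOSED
  point at which `𝒪_{Y,y}/X_y` is not regular (closed specialisation `exists_isClosed_and_specializes_of_jacobsonSpace`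
  + regularity of `𝒪_{Y,y}/X_y` generises, Matsumura 19.3, tree `isRegularLocalRing_quotient_stalkIdeal_of_specializes`);
* `exists_isRegularWeightedCentre_support_subset_singular` — for `f : Y → Spec k` smooth and `X` an ideal sheaf
  with NON-regular `V(X)`, there is a regular weighted centre `R` on `Y` (the powers of the ideal of a reduced
  closed singular point, `isRegularWeightedCentre_powers_of_isRegular` + `isRegular_subscheme_vanishingIdeal_singleton`)
  with non-empty support contained in `{y | ∃ x : V(X), ι x = y ∧ 𝒪_{V(X),x} not regular}`;
* `exists_isRegularWeightedCentre_support_subset_not_isBot` — the same with the conclusion phrased through any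
  rating `inv` satisfying the datum's axiom `(ii)` (`IsBot (inv y) ↔ V(X) regular over y`), i.e. literally the
  shape of clauses `(iii-a)` + `(iii-b′)` of `HypersurfaceTerminatingCentreDatum`.

What this is NOT: no `(hom)` (torus-homogeneity on graded charts — a closed point of a positive-dimensional
singular locus is in general NOT homogeneous; the memo's `(hom)`-compatible centre is the intrinsic regular
stratum of `Sing V(X)`, not formalised here) and no `(term)`. AI-written; weaker than expert review.

References: J. Włodarczyk, arXiv:2203.03090, 2.1.10 [Wlodarczyk2022]; H. Matsumura, *Commutative Ring Theory*
(1986), Thm. 19.3 [Matsumura1987].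
-/

noncomputable section

open CategoryTheory AlgebraicGeometry TopologicalSpace IsLocalRing
open Literature.AlgebraicGeometry.Resolution

set_option linter.dupNamespace false -- mandated namespace of this single-conjunct summit

namespace Summit.ResolutionOfSingularities.ResolutionOfSingularities.Theorems

universe u

/-- **A non-regular closed subscheme of a Jacobson locally Noetherian scheme has a CLOSED non-regular point**:
if `V(X)` is not regular there is a closed point `y ∈ V(X)` of `Y` with `𝒪_{Y,y}/X_y` not a regular local ring
(a non-regular point specialises to a closed point, and regularity of the quotient stalks generises — Serre,
Matsumura 19.3). [cite: Matsumura1987, Thm. 19.3] -/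
theorem exists_isClosed_not_isRegularLocalRing_quotient {Y : Scheme.{u}} [IsLocallyNoetherian Y]
    [JacobsonSpace Y] (X : Y.IdealSheafData) (hX : ¬ Scheme.IsRegular X.subscheme) :
    ∃ y : Y, IsClosed ({y} : Set Y) ∧ y ∈ X.support ∧
      ¬ IsRegularLocalRing (Y.presheaf.stalk y ⧸ stalkIdeal X y) := by
  obtain ⟨y₀, hy₀, hsing₀⟩ : ∃ y₀ ∈ X.support,
      ¬ IsRegularLocalRing (Y.presheaf.stalk y₀ ⧸ stalkIdeal X y₀) := by
    by_contra h
    push Not at h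
    exact hX ((Scheme.isRegular_subscheme_iff X).mpr h)
  obtain ⟨y₁, hy₁cl, hsp⟩ := exists_isClosed_and_specializes_of_jacobsonSpace y₀
  have hy₁ : y₁ ∈ X.support := hsp.mem_closed X.support.isClosed hy₀
  exact ⟨y₁, hy₁cl, hy₁, fun h => hsing₀ (isRegularLocalRing_quotient_stalkIdeal_of_specializes X hsp hy₀ h)⟩

/-- **At every singular pair the `(iii-a)`+`(iii-b′)`-admissible centres are non-empty.** Let `f : Y → Spec k`
be smooth over a field and `X` an ideal sheaf on `Y` whose closed subscheme `V(X)` is NOT regular. Then there is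
a Rees algebra `R` on `Y` which is a regular weighted centre (Włodarczyk 2.1.10) with non-empty support contained
in the image of the non-regular locus of `V(X)`: the powers of the ideal of the reduced closed point at a closed
non-regular point of `V(X)` (`isRegularWeightedCentre_powers_of_isRegular`,
`isRegular_subscheme_vanishingIdeal_singleton`, `exists_isClosed_not_isRegularLocalRing_quotient`). OURS; a
non-vacuity witness for the door `HypersurfaceCentreConstruction`, NOT a step of its proof (no `(hom)`, no `(term)`).
[cite: Wlodarczyk2022, 2.1.10] -/
theorem exists_isRegularWeightedCentre_support_subset_singular {k : Type u} [Field k] {Y : Scheme.{u}}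
    (f : Y ⟶ Spec (.of k)) [Smooth f] (X : Y.IdealSheafData) (hX : ¬ Scheme.IsRegular X.subscheme) :
    ∃ R : ReesAlgebraData Y, R.IsRegularWeightedCentre ∧ (R.support).Nonempty ∧
      R.support ⊆ {y : Y | ∃ x : X.subscheme, X.subschemeι x = y ∧
        ¬ IsRegularLocalRing (X.subscheme.presheaf.stalk x)} := by
  haveI : IsLocallyNoetherian Y := LocallyOfFiniteType.isLocallyNoetherian f
  haveI : JacobsonSpace Y := LocallyOfFiniteType.jacobsonSpace f
  obtain ⟨y₁, hy₁cl, hy₁, hsing₁⟩ := exists_isClosed_not_isRegularLocalRing_quotient X hX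
  -- the centre: powers of the ideal of the reduced closed point `{y₁}`
  let Z : Closeds Y := ⟨{y₁}, hy₁cl⟩
  have hJ : Scheme.IsRegular (Scheme.IdealSheafData.vanishingIdeal Z).subscheme :=
    isRegular_subscheme_vanishingIdeal_singleton hy₁cl
  obtain ⟨R, hR, hsupp, -⟩ :=
    exists_isRegularWeightedCentre_support_eq_of_smooth f (Scheme.IdealSheafData.vanishingIdeal Z) hJ
  have hsuppZ : R.support = {y₁} := by
    rw [hsupp, Scheme.IdealSheafData.coe_support_vanishingIdeal]
    rfl
  refine ⟨R, hR, ⟨y₁, hsuppZ ▸ rfl⟩, ?_⟩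
  rw [hsuppZ]
  intro y hy
  rw [Set.mem_singleton_iff] at hy
  rw [hy, Set.mem_setOf_eq]
  obtain ⟨x, hx⟩ : y₁ ∈ Set.range X.subschemeι := by
    rw [Scheme.IdealSheafData.range_subschemeι]
    exact hy₁
  refine ⟨x, hx, fun hreg => hsing₁ ?_⟩
  rw [isRegularLocalRing_stalk_subscheme_iff] at hreg
  have hx' : X.subschemeι.base x = y₁ := hx
  rwa [hx'] at hreg

/-- **The same, in the letter of the datum's clauses `(iii-a)` + `(iii-b′)`**: for any rating `inv` of the points
of `Y` in a partial order with bottom satisfying axiom `(ii)` over `(Y, X)` («`inv y` is minimal iff `V(X)` is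
regular at every point over `y`»), a singular `V(X)` admits a regular weighted centre with non-empty support
inside `{y | ¬ IsBot (inv y)}`. [cite: Wlodarczyk2022, 2.1.10] -/
theorem exists_isRegularWeightedCentre_support_subset_not_isBot {k : Type u} [Field k] {Y : Scheme.{u}}
    (f : Y ⟶ Spec (.of k)) [Smooth f] (X : Y.IdealSheafData) (hX : ¬ Scheme.IsRegular X.subscheme)
    {Γ : Type*} [PartialOrder Γ] [OrderBot Γ] (inv : Y → Γ)
    (hii : ∀ y : Y, IsBot (inv y) ↔
      ∀ x : X.subscheme, X.subschemeι x = y → IsRegularLocalRing (X.subscheme.presheaf.stalk x)) :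
    ∃ R : ReesAlgebraData Y, R.IsRegularWeightedCentre ∧ (R.support).Nonempty ∧
      R.support ⊆ {y : Y | ¬ IsBot (inv y)} := by
  obtain ⟨R, hR, hne, hsub⟩ := exists_isRegularWeightedCentre_support_subset_singular f X hX
  refine ⟨R, hR, hne, fun y hy => ?_⟩
  obtain ⟨x, hx, hnot⟩ := hsub hy
  rw [Set.mem_setOf_eq, hii]
  exact fun h => hnot (h x hx)

end Summit.ResolutionOfSingularities.ResolutionOfSingularities.Theorems

end
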